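import Summits.Langlands.Langlands.Theorems.IrreducibilityBySelfDualityIrreducibleOffSectorOfWeakTwoLe
import HarnessLib

/-!
# `IrreducibleOffSector` in rank three from `E`-rational weak existence and weak Fontaine–Mazur–Langlands for `GL_2`
(crux stmt-Langlands-14329 `IrreducibilityBySelfDuality.IrreducibleOffSector`, line `Sketch`;
`--supports` file, STRUCTURAL: no import of the route module; continuation lead c8, CONSTITUENT package)

The rank-three slice of the crux's text — every number field `K`, EVERY L-algebraic cuspidal `π` on
`GL_3(𝔸_K)` (regular or not, inside or outside the CM sector), every `ℓ`, `ι`, `ρ` — follows from: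
Böckle–Hui 2025 Thm. 1.1 (`hWA`, the `WeakAbelianSummandHecke` text, a theorem of the tree);
Arthur–Clozel (2.2) (`h22`); (W_rat, rank 3) every L-algebraic cuspidal `π` on `GL_3(𝔸_K)` has, for
all `ℓ, ι`, ONE avatar unramified a.e., de Rham above `ℓ` (pinned datum), Satake–Frobenius compatible
a.e. and with Frobenius polynomials over a number field a.e. (Buzzard–Gee 3.2.2 with 3.1.6); and
(B_w, rank 2) weak automorphy of irreducible a.e.-unramified de Rham `r : Γ_K → GL_2(ℚ̄_ℓ)` — some
cuspidal datum on `GL_2(𝔸_K)` is Satake–Frobenius compatible with `(r, ι)` a.e. (Fontaine–Mazur–Langlands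
for `GL_2`, weak form).  NO (2.3) hypothesis (ranks `≤ 2` are theorems) and NO rank-one / rank-three
automorphy input: `irreducibleOffSector_text_rank_three_of_rational_weak_two`, from
`isIrreducible_rank_three_of_rational_geometric_of_weakAutomorphy_two` (p131040).

References: F. Calegari, T. Gee, Ann. Inst. Fourier 63 (2013), §1.1; G. Böckle, C.-Y. Hui, Math. Ann.
393 (2025), Thm. 1.1; K. Buzzard, T. Gee, LMS LNS 414 (2014), Conj. 3.1.6, 3.2.2; J.-M. Fontaine,
B. Mazur (1995), Conj. 1.
-/

noncomputable section

set_option linter.dupNamespace false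

open scoped NumberField Classical Polynomial
open Filter IsDedekindDomain Polynomial NumberField
open Literature.NumberTheory.Automorphic Literature.NumberTheory.GaloisRepresentations
open Summit.Langlands

namespace Summit.Langlands.Langlands.Theorems.IrreducibleOffSector

/-- **The rank-three text of `IrreducibleOffSector` from `E`-rational weak existence in rank three and
weak Fontaine–Mazur–Langlands for irreducible geometric two-dimensional representations** (structural
form; the item's binders with `n` specialised to `3`, sector clause kept and unused).  Hypotheses:
`hWA` (Böckle–Hui Thm. 1.1, the `WeakAbelianSummandHecke` text), `h22` (Arthur–Clozel (2.2)), `hWrat3`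
(one `E`-rational pinned-geometric a.e.-compatible avatar for every L-algebraic cuspidal `π` on `GL_3`),
`hBw2` (every irreducible a.e.-unramified de Rham `r : Γ_K → GL_2(ℚ̄_ℓ)` is a.e.-compatible with some
cuspidal datum on `GL_2(𝔸_K)`). [cite: CalegariGee2013, §1.1] [cite: BuzzardGeeLMS2014, Conj. 3.1.6 and 3.2.2] -/
theorem irreducibleOffSector_text_rank_three_of_rational_weak_two
    (hWA : ∀ (K : Type) [Field K] [NumberField K] (h1 : isCompact_glFiniteIntegralLevel 1 K) (ℓ : ℕ) [Fact ℓ.Prime] (n : ℕ) (E : Type) [Field E] [NumberField E] (e : E →+* PadicAlgCl ℓ) (ρ : Literature.NumberTheory.GaloisRepresentations.FramedGaloisRep K (PadicAlgCl ℓ) n), ρ.toGaloisRep.IsSemisimple → (∀ᶠ v in cofinite, ρ.IsUnramifiedAt v ∧ ∃ P : Polynomial E, ρ.HasFrobCharpolyAt v (P.map e)) → ∀ (ψ : Literature.NumberTheory.GaloisRepresentations.FramedGaloisRep K (PadicAlgCl ℓ) 1), (∀ᶠ v in cofinite, ρ.IsUnramifiedAt v ∧ ψ.IsUnramifiedAt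 v ∧ ∀ 𝔓 ∈ v.primesAbove, ∀ σ : Field.absoluteGaloisGroup K, IsArithFrobAt (NumberField.RingOfIntegers K) σ 𝔓 → ψ.charpoly σ ∣ ρ.charpoly σ) → ∀ (ι : PadicAlgCl ℓ ≃+* ℂ), ∃ χ : Literature.NumberTheory.Automorphic.CuspidalAutomorphicRepData 1 K h1, χ.1.IsRegularAlgebraic ∧ ∀ᶠ v in cofinite, ∃ c : ℂ, χ.1.HasSatakeParamAt v {c} ∧ ψ.IsUnramifiedAt v ∧ ψ.HasFrobCharpolyAt v (Literature.NumberTheory.Automorphic.arithFrobPolyOfSatake ι v.residueCard 1 {c}))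
    (h22 : JacquetShalika1981_partialPairL_boundary_repData)
    (hWrat3 : ∀ (K : Type) [Field K] [NumberField K] (hcpt : isCompact_glFiniteIntegralLevel 3 K) (π : CuspidalAutomorphicRepData 3 K hcpt), π.1.IsLAlgebraic → ∀ (ℓ : ℕ) [Fact ℓ.Prime] (ι : PadicAlgCl ℓ ≃+* ℂ), ∃ ρ : FramedGaloisRep K (PadicAlgCl ℓ) 3, ((∀ᶠ v : HeightOneSpectrum (𝓞 K) in cofinite, ρ.IsUnramifiedAt v) ∧ ∀ (v : HeightOneSpectrum (𝓞 K)) (hv : ((ℓ : ℕ) : 𝓞 K) ∈ v.asIdeal), (Literature.NumberTheory.PAdicHodge.fontainePstAdicCompletion v ℓ hv).IsDeRhamFramed (ρ.toLocal v)) ∧ (∀ᶠ v : HeightOneSpectrum (𝓞 K) in cofinite, SatakeFrobCompatibleAt ι π.1 ρ v) ∧ ∃ (E : Type) (_ : Field E) (_ : NumberField E) (e : E →+* PadicAlgCl ℓ), ∀ᶠ v : HeightOneSpectrum (𝓞 K) in cofinite, ρ.IsUnramifiedAt v ∧ ∃ P : Polynomial E, ρ.HasFrobCharpolyAt v (P.map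 e))
    (hBw2 : ∀ (K : Type) [Field K] [NumberField K] (h2 : isCompact_glFiniteIntegralLevel 2 K) (ℓ : ℕ) [Fact ℓ.Prime] (ι : PadicAlgCl ℓ ≃+* ℂ) (r : FramedGaloisRep K (PadicAlgCl ℓ) 2), r.toGaloisRep.IsIrreducible → ((∀ᶠ v : HeightOneSpectrum (𝓞 K) in cofinite, r.IsUnramifiedAt v) ∧ ∀ (v : HeightOneSpectrum (𝓞 K)) (hv : ((ℓ : ℕ) : 𝓞 K) ∈ v.asIdeal), (Literature.NumberTheory.PAdicHodge.fontainePstAdicCompletion v ℓ hv).IsDeRhamFramed (r.toLocal v)) → ∃ σ : CuspidalAutomorphicRepData 2 K h2, ∀ᶠ v : HeightOneSpectrum (𝓞 K) in cofinite, SatakeFrobCompatibleAt ι σ.1 r v) :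
    ∀ (K : Type) [Field K] [NumberField K] (hcpt : Literature.NumberTheory.Automorphic.isCompact_glFiniteIntegralLevel 3 K), 0 < 3 → ∀ (π : Literature.NumberTheory.Automorphic.CuspidalAutomorphicRepData 3 K hcpt), π.1.IsLAlgebraic → ¬ (3 = 3 ∧ NumberField.IsCMField K ∧ ∃ T : Literature.NumberTheory.Automorphic.InfinityType K 3, π.1.HasInfinityType T ∧ T.IsRegular) → ∀ (ℓ : ℕ) [Fact ℓ.Prime] (ι : PadicAlgCl ℓ ≃+* ℂ) (ρ : Literature.NumberTheory.GaloisRepresentations.FramedGaloisRep K (PadicAlgCl ℓ) 3), (∀ᶠ v : IsDedekindDomain.HeightOneSpectrum (NumberField.RingOfIntegers K) in cofinite, SatakeFrobCompatibleAt ι π.1 ρ v) → ρ.toGaloisRep.IsIrreducible := by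
  intro K _ _ hcpt _ π hL _ ℓ _ ι ρ hρ
  obtain ⟨ρ₀, hgeo₀, hρ₀, E, _, _, e, hrat₀⟩ := hWrat3 K hcpt π hL ℓ ι
  exact isIrreducible_rank_three_of_rational_geometric_of_weakAutomorphy_two hWA h22 π ι e hgeo₀ hρ₀
    hrat₀ (fun h2 r hirr hgeo => hBw2 K h2 ℓ ι r hirr hgeo) ρ hρ

end Summit.Langlands.Langlands.Theorems.IrreducibleOffSector

end
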